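import Summits.AtomisticToContinuum.FouriersLaw.Theses.ContactStieltjesMeasure
import Summits.AtomisticToContinuum.FouriersLaw.Theorems.ContactStieltjesMeasureStieltjesRepresentationStubStieltjesOfPencil
import Summits.AtomisticToContinuum.FouriersLaw.Theorems.ContactStieltjesMeasureStieltjesRepresentationStubHarmonicMember
import Summits.AtomisticToContinuum.FouriersLaw.Theorems.ContactStieltjesMeasureStieltjesRepresentationStubBoundaryGreenKuboNonneg
import Summits.AtomisticToContinuum.FouriersLaw.Theorems.ContactStieltjesMeasureStieltjesRepresentationStubPencilOfGreenKubo
import Literature.MathematicalPhysics.KineticTheory.LangevinChainKernel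

/-!
# Skeleton v5 (continuation lead c1, 2026-08-17T14:50Z) = v4 UNCHANGED below (1 `sorry`: `stub_phi4Edge`)

State: every stub of the line except `stub_phi4Edge` (the `φ⁴` edge `β = 0 < lam`) is LANDED; in addition the tree now has
`Theorems/ContactStieltjesMeasureStieltjesRepresentationNarrowed.lean` (p167063): `stub_stieltjesRepresentation_narrowed`
(the crux on `0 ≤ lam ∧ (0 < β ∨ lam = β = 0)`, sorry-free — the candidate restatement) and
`stieltjesRepresentation_iff_phi4Edge` (the crux AS FILED ⇔ its `φ⁴`-edge member). The edge is the fixed-`N` linear-response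
clause for the discrete `φ⁴` chain (quartic pinning, harmonic coupling) at every `N ≥ 2`, outside CEHR 2018 C5; existence of
its steady state is open beyond `N = 3` (Hairer–Mattingly 2009 §1; barrier `StrongPinningBreathers*`), so the stub is
vacuous-or-open and the lead's verdict is `misstated (range)`.
-/

/-!
# Line `cayley-pencil` (`Lines/cayley-pencil.lean`) for crux `StieltjesRepresentation`
# (stmt-AtomisticToContinuum-15248), route `ContactStieltjesMeasure`, sub-problem `FouriersLaw` — skeleton v4 (lead)

The crux (K2): for `pinnedChain ω₂ lam β γ`, `ω₂ > 0`, `lam, β ≥ 0`, `T > 0`, ONE `γ`-free family of bounded monotone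
`Φ_N` vanishing on `(-∞,0]` with `totalCurrent(μ_{N,T+δ/2,T-δ/2})/δ → (N-1)·γ·∫₀^∞ Φ_N(t)·2t/(γ²+t²)² dt` for EVERY
`γ > 0` (under weak-NESS uniqueness, along every steady family).

## The lever (strategist, line card `Lines/cayley-pencil.md`)

Friction is a genuine RESOLVENT PARAMETER of a dissipative operator pencil: with `L_γ = A - γS` (`A` the Liouvillian,
skew in `L²(μ_T)`; `S = D*D ≥ 0` the `γ`-FREE Ornstein–Uhlenbeck operator of `p_0, p_{N-1}`, `D = √T(∂_{p_0}, ∂_{p_{N-1}})`)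
and `W(γ) := D R_γ D*` (`R_γ v` = the Poisson solution `∫₀^∞ P^γ_t v dt`), two EXACT finite-`N` identities hold —
(R) `W(γ) - W(γ') = (γ' - γ) W(γ) W(γ')` and (E) `⟪F, W(γ) F⟫ = γ ‖W(γ) F‖²` (all entropy is produced at the contacts) —
and the two-terminal conductance is a DIAGONAL matrix element `G_N(γ) = ⟪g, W(γ) g⟫`, `D*g = p_0 ∂_{q_0}H / T`. (E) makes the
Cayley transform an isometry, (R) resums `W(γ)` in it, Herglotz + `s = tan(θ/2)` + layer cake give the crux's `Φ_N`.

## The cut (v4, 2026-08-17: five statements, FOUR LANDED, one OPEN registered stub)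

History: v1 (strategist, 2026-08-17T09:49Z) had four stubs; the lead split `stub_closedBoundary` into `stub_harmonicMember` +
`stub_mixedEdges` (v2, 11:50Z); wave 1 LANDED `stub_stieltjesOfPencil` (p160533), `stub_boundaryGreenKubo` (p160807, `0 < lam`),
`stub_harmonicMember` (p160339), and showed `stub_mixedEdges` MIS-STATED: the whole open-chain Green–Kubo cone re-elaborates at
`0 ≤ lam` (`openChainGreenKubo_of_nonneg`, p160347), so the edge `lam = 0 < β` joins the open range and only the `φ⁴` edge
`β = 0 < lam` remains outside the tree's technology. v3 WIDENED stubs 1–2 to `0 ≤ lam` and shrank the boundary stub to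
`stub_phi4Edge`; v4 records that stubs 1–2 have LANDED (the lead: p161365; p165213 with the twelve `Pencil*` helper files
p161897–p164849). Registered-stub statements are written `let`-FREE (the registration parser cuts at the first `:=`).

* `stub_boundaryGreenKuboNonneg` — LANDED (`Theorems.ContactStieltjesMeasure.CayleyPencil.stub_boundaryGreenKuboNonneg`, p161365).
* `stub_pencilOfGreenKubo` — LANDED (`Theorems.ContactStieltjesMeasure.CayleyPencil.stub_pencilOfGreenKubo`, p165213): `K = L²(μ_T)²`,
  `W(γ) = D R_γ D*` extended by continuity from nice vector fields (η = 0 exact pencil: smooth Poisson solutions of the tree,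
  (E) = the Dirichlet identity, (R)/(A)/(C) by energy-cutoff integration by parts, Lax–Phillips extension lemma).
* `StieltjesOfPencil` — LANDED (`Theorems.ContactStieltjesMeasure.CayleyPencil.stub_stieltjesOfPencil`, p160533).
* `HarmonicMember` (`lam = β = 0`) — LANDED (`Theorems.ContactStieltjesMeasure.CayleyPencil.stub_harmonicMember`, p160339).
* `stub_phi4Edge` (OPEN, vacuous-or-open: `β = 0 < lam`, the discrete `φ⁴` chain; CEHR C5 fails, NESS existence open for
  `N ≥ 4`, barrier `HairerMattingly2009_threeOscillators` / `StrongPinningBreathersNarrow`; no Harris bound in the tree) —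
  EXACTLY the part of the crux's range outside `(0 ≤ lam ∧ 0 < β) ∨ (lam = β = 0)`; the narrowing candidate.

`StieltjesRepresentation_of` composes them into the crux BY NAME (kernel-checked; the only `sorry` left is `stub_phi4Edge`).

## Disproof used
None exists for stmt-15248 (no `Disproof.lean` in the crux directory as of 2026-08-17T12:45Z; crux-attack verdict SURVIVES).
-/

noncomputable section

open scoped NNReal ENNReal Topology BigOperators
open MeasureTheory Filter Set
open Literature.MathematicalPhysics.KineticTheory.HeatConduction

namespace Summit.AtomisticToContinuum.FouriersLaw.Cruxes.StieltjesRepresentation.CayleyPencil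

/-! ### The five statements of the line (named) -/

/-- STUB 1 statement (v3, widened to `0 ≤ lam`) — OPEN-CHAIN GREEN–KUBO IN BOUNDARY-POWER FORM: under weak-NESS uniqueness,
along every steady family, for `T > 0`, `N ≥ 2`, the response quotient converges to `(N-1)·(∫₀^∞ corr)/T²` with
`corr(t) = Cov_{μ_T}(g₀, P^γ_t g₀)`, `g₀ = p_0 ∂_{q_0}H`, and `corr ∈ L¹(0,∞)`. Written `let`-free.
[cite: KunduDharNarayan2009, p. 3] [cite: CuneoEckmannHairerReyBellet2018, Thm 2.13] -/
def BoundaryGreenKuboNonneg : Prop :=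
  ∀ ω₂ lam β γ : ℝ, 0 < ω₂ → 0 ≤ lam → 0 < β → 0 < γ →
      (∀ (N : ℕ) (T_L T_R : ℝ), 0 < T_L → 0 < T_R → ∀ μ ν : Measure (PhaseSpace N),
        (pinnedChain ω₂ lam β γ).IsSteadyState N T_L T_R μ →
        (pinnedChain ω₂ lam β γ).IsSteadyState N T_L T_R ν → μ = ν) →
      ∀ μf : (N : ℕ) → ℝ → ℝ → Measure (PhaseSpace N),
        (∀ (N : ℕ) (T_L T_R : ℝ), 0 < T_L → 0 < T_R →
          (pinnedChain ω₂ lam β γ).IsSteadyState N T_L T_R (μf N T_L T_R)) →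
      ∀ T : ℝ, 0 < T → ∀ (N : ℕ) (hN : 2 ≤ N),
        IntegrableOn (fun t : ℝ =>
            (∫ z, (z.2 ⟨0, by omega⟩ * partialQ ⟨0, by omega⟩ ((pinnedChain ω₂ lam β γ).hamiltonian N) z) *
                (∫ y, y.2 ⟨0, by omega⟩ * partialQ ⟨0, by omega⟩ ((pinnedChain ω₂ lam β γ).hamiltonian N) y
                  ∂((pinnedChain ω₂ lam β γ).transitionKernel N T T t.toNNReal z)) ∂((pinnedChain ω₂ lam β γ).gibbsMeasure N T)) -
              (∫ z, z.2 ⟨0, by omega⟩ * partialQ ⟨0, by omega⟩ ((pinnedChain ω₂ lam β γ).hamiltonian N) z ∂((pinnedChain ω₂ lam β γ).gibbsMeasure N T)) *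
                (∫ z, z.2 ⟨0, by omega⟩ * partialQ ⟨0, by omega⟩ ((pinnedChain ω₂ lam β γ).hamiltonian N) z ∂((pinnedChain ω₂ lam β γ).gibbsMeasure N T))) (Set.Ioi 0) ∧
        Tendsto (fun δ : ℝ => (pinnedChain ω₂ lam β γ).totalCurrent (μf N (T + δ / 2) (T - δ / 2)) / δ) (𝓝[≠] 0)
          (𝓝 (((N : ℝ) - 1) * ((∫ t in Set.Ioi (0 : ℝ), (fun t : ℝ =>
            (∫ z, (z.2 ⟨0, by omega⟩ * partialQ ⟨0, by omega⟩ ((pinnedChain ω₂ lam β γ).hamiltonian N) z) *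
                (∫ y, y.2 ⟨0, by omega⟩ * partialQ ⟨0, by omega⟩ ((pinnedChain ω₂ lam β γ).hamiltonian N) y
                  ∂((pinnedChain ω₂ lam β γ).transitionKernel N T T t.toNNReal z)) ∂((pinnedChain ω₂ lam β γ).gibbsMeasure N T)) -
              (∫ z, z.2 ⟨0, by omega⟩ * partialQ ⟨0, by omega⟩ ((pinnedChain ω₂ lam β γ).hamiltonian N) z ∂((pinnedChain ω₂ lam β γ).gibbsMeasure N T)) *
                (∫ z, z.2 ⟨0, by omega⟩ * partialQ ⟨0, by omega⟩ ((pinnedChain ω₂ lam β γ).hamiltonian N) z ∂((pinnedChain ω₂ lam β γ).gibbsMeasure N T))) t) / T ^ 2)))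

/-- STUB 2 statement (v3, widened to `0 ≤ lam`) — THE DISSIPATIVE PENCIL BEHIND THE BOUNDARY GREEN–KUBO FUNCTION: for each
`N ≥ 2` a real inner-product space `K`, a family `W : ℝ → K →L[ℝ] K` satisfying the pencil resolvent identity (R) and the
energy identity (E) for positive parameters, and a vector `g` whose diagonal matrix elements are the boundary Green–Kubo
integrals: `⟪g, W γ g⟫ = (∫₀^∞ corr_γ)/T²` for every `γ > 0` (guarded by integrability). Written `let`-free.
[cite: LaxPhillips1967, Ch. II §3] [cite: KipnisVaradhan1986, Thm 1.8] -/
def PencilOfGreenKubo : Prop :=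
  ∀ ω₂ lam β : ℝ, 0 < ω₂ → 0 ≤ lam → 0 < β → ∀ T : ℝ, 0 < T → ∀ (N : ℕ) (hN : 2 ≤ N),
      ∃ (K : Type) (_ : NormedAddCommGroup K) (_ : InnerProductSpace ℝ K) (W : ℝ → K →L[ℝ] K) (g : K),
        (∀ γ γ' : ℝ, 0 < γ → 0 < γ' → ∀ f : K, W γ f - W γ' f = (γ' - γ) • W γ (W γ' f)) ∧
        (∀ γ : ℝ, 0 < γ → ∀ f : K, inner ℝ f (W γ f) = γ * ‖W γ f‖ ^ 2) ∧
        ∀ γ : ℝ, 0 < γ →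
          IntegrableOn (fun t : ℝ =>
            (∫ z, (z.2 ⟨0, by omega⟩ * partialQ ⟨0, by omega⟩ ((pinnedChain ω₂ lam β γ).hamiltonian N) z) *
                (∫ y, y.2 ⟨0, by omega⟩ * partialQ ⟨0, by omega⟩ ((pinnedChain ω₂ lam β γ).hamiltonian N) y
                  ∂((pinnedChain ω₂ lam β γ).transitionKernel N T T t.toNNReal z)) ∂((pinnedChain ω₂ lam β γ).gibbsMeasure N T)) -
              (∫ z, z.2 ⟨0, by omega⟩ * partialQ ⟨0, by omega⟩ ((pinnedChain ω₂ lam β γ).hamiltonian N) z ∂((pinnedChain ω₂ lam β γ).gibbsMeasure N T)) *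
                (∫ z, z.2 ⟨0, by omega⟩ * partialQ ⟨0, by omega⟩ ((pinnedChain ω₂ lam β γ).hamiltonian N) z ∂((pinnedChain ω₂ lam β γ).gibbsMeasure N T))) (Set.Ioi 0) →
            inner ℝ g (W γ g) = (∫ t in Set.Ioi (0 : ℝ), (fun t : ℝ =>
            (∫ z, (z.2 ⟨0, by omega⟩ * partialQ ⟨0, by omega⟩ ((pinnedChain ω₂ lam β γ).hamiltonian N) z) *
                (∫ y, y.2 ⟨0, by omega⟩ * partialQ ⟨0, by omega⟩ ((pinnedChain ω₂ lam β γ).hamiltonian N) y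
                  ∂((pinnedChain ω₂ lam β γ).transitionKernel N T T t.toNNReal z)) ∂((pinnedChain ω₂ lam β γ).gibbsMeasure N T)) -
              (∫ z, z.2 ⟨0, by omega⟩ * partialQ ⟨0, by omega⟩ ((pinnedChain ω₂ lam β γ).hamiltonian N) z ∂((pinnedChain ω₂ lam β γ).gibbsMeasure N T)) *
                (∫ z, z.2 ⟨0, by omega⟩ * partialQ ⟨0, by omega⟩ ((pinnedChain ω₂ lam β γ).hamiltonian N) z ∂((pinnedChain ω₂ lam β γ).gibbsMeasure N T))) t) / T ^ 2

/-- STUB 3 statement — STIELTJES REPRESENTATION OF A DISSIPATIVE PENCIL (abstract; LANDED as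
`Theorems.ContactStieltjesMeasure.CayleyPencil.stub_stieltjesOfPencil`). [cite: LaxPhillips1967, Ch. II §3 eqs. (3.1)-(3.6)]
[cite: Katznelson2004, Ch. I §7] -/
def StieltjesOfPencil : Prop :=
  ∀ (K : Type) [NormedAddCommGroup K] [InnerProductSpace ℝ K] (W : ℝ → K →L[ℝ] K),
      (∀ γ γ' : ℝ, 0 < γ → 0 < γ' → ∀ f : K, W γ f - W γ' f = (γ' - γ) • W γ (W γ' f)) →
      (∀ γ : ℝ, 0 < γ → ∀ f : K, inner ℝ f (W γ f) = γ * ‖W γ f‖ ^ 2) →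
      ∀ g : K, ∃ Φ : ℝ → ℝ, Monotone Φ ∧ (∀ s : ℝ, s ≤ 0 → Φ s = 0) ∧ (∀ s : ℝ, Φ s ≤ ‖g‖ ^ 2) ∧
        ∀ γ : ℝ, 0 < γ →
          inner ℝ g (W γ g) = γ * ∫ t in Set.Ioi (0 : ℝ), Φ t * (2 * t / (γ ^ 2 + t ^ 2) ^ 2)

/-- STUB 4a statement — THE HARMONIC MEMBER `lam = β = 0` (LANDED as `Theorems.ContactStieltjesMeasure.CayleyPencil.stub_harmonicMember`).
[cite: RoyDhar2008, §2 eq. (2.8)] [cite: RiederLebowitzLieb1967, eq. (4.1)] -/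
def HarmonicMember : Prop :=
  ∀ ω₂ : ℝ, 0 < ω₂ → ∀ T : ℝ, 0 < T →
      ∃ Φ : ℕ → ℝ → ℝ, ∀ N : ℕ, 2 ≤ N → Monotone (Φ N) ∧ (∀ s : ℝ, s ≤ 0 → Φ N s = 0) ∧
        (∃ m : ℝ, ∀ s : ℝ, Φ N s ≤ m) ∧ ∀ γ : ℝ, 0 < γ →
          (∀ (N' : ℕ) (T_L T_R : ℝ), 0 < T_L → 0 < T_R → ∀ μ ν : Measure (PhaseSpace N'),
            (pinnedChain ω₂ 0 0 γ).IsSteadyState N' T_L T_R μ →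
            (pinnedChain ω₂ 0 0 γ).IsSteadyState N' T_L T_R ν → μ = ν) →
          ∀ μ : (N' : ℕ) → ℝ → ℝ → Measure (PhaseSpace N'),
            (∀ (N' : ℕ) (T_L T_R : ℝ), 0 < T_L → 0 < T_R →
              (pinnedChain ω₂ 0 0 γ).IsSteadyState N' T_L T_R (μ N' T_L T_R)) →
            Tendsto (fun δ : ℝ => (pinnedChain ω₂ 0 0 γ).totalCurrent (μ N (T + δ / 2) (T - δ / 2)) / δ)
              (𝓝[≠] 0)
              (𝓝 (((N : ℝ) - 1) * γ * ∫ t in Set.Ioi (0 : ℝ), Φ N t * (2 * t / (γ ^ 2 + t ^ 2) ^ 2)))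

/-- STUB 4b statement (v3) — THE `φ⁴` EDGE `β = 0 < lam`: the crux's clause for `pinnedChain ω₂ lam 0 γ` (quartic pinning,
harmonic coupling: the discrete `φ⁴` chain). Pinning dominates the coupling (CEHR 2018 condition C5 fails), existence of the
non-equilibrium steady state is open for `N ≥ 4` (Hairer–Mattingly 2009), the tree has no Harris/mixing bound there and the
Green–Kubo integral is not known to converge: the clause's hypotheses (uniqueness AND a steady family for ALL `N', T_L, T_R`)
can be neither discharged nor refuted today — VACUOUS-OR-OPEN, the tenure narrowing candidate (recommended crux range:
`(0 ≤ lam ∧ 0 < β) ∨ (lam = 0 ∧ β = 0)`). [cite: HairerMattingly2009, §1] [cite: CuneoEckmannHairerReyBellet2018, §1] -/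
def Phi4Edge : Prop :=
  ∀ ω₂ lam : ℝ, 0 < ω₂ → 0 < lam → ∀ T : ℝ, 0 < T →
      ∃ Φ : ℕ → ℝ → ℝ, ∀ N : ℕ, 2 ≤ N → Monotone (Φ N) ∧ (∀ s : ℝ, s ≤ 0 → Φ N s = 0) ∧
        (∃ m : ℝ, ∀ s : ℝ, Φ N s ≤ m) ∧ ∀ γ : ℝ, 0 < γ →
          (∀ (N' : ℕ) (T_L T_R : ℝ), 0 < T_L → 0 < T_R → ∀ μ ν : Measure (PhaseSpace N'),
            (pinnedChain ω₂ lam 0 γ).IsSteadyState N' T_L T_R μ →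
            (pinnedChain ω₂ lam 0 γ).IsSteadyState N' T_L T_R ν → μ = ν) →
          ∀ μ : (N' : ℕ) → ℝ → ℝ → Measure (PhaseSpace N'),
            (∀ (N' : ℕ) (T_L T_R : ℝ), 0 < T_L → 0 < T_R →
              (pinnedChain ω₂ lam 0 γ).IsSteadyState N' T_L T_R (μ N' T_L T_R)) →
            Tendsto (fun δ : ℝ => (pinnedChain ω₂ lam 0 γ).totalCurrent (μ N (T + δ / 2) (T - δ / 2)) / δ)
              (𝓝[≠] 0)
              (𝓝 (((N : ℝ) - 1) * γ * ∫ t in Set.Ioi (0 : ℝ), Φ N t * (2 * t / (γ ^ 2 + t ^ 2) ^ 2)))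

/-! ### Registered stubs (`sorry` only here; `let`-free statements over importable declarations) -/

/-- STUB 1 (v4: LANDED as `Theorems.ContactStieltjesMeasure.CayleyPencil.stub_boundaryGreenKuboNonneg`, p161365): open-chain Green–Kubo in boundary-power form, `0 ≤ lam`, `0 < β`.
[cite: KunduDharNarayan2009, p. 3] [cite: CuneoEckmannHairerReyBellet2018, Thm 2.13] -/
theorem stub_boundaryGreenKuboNonneg :
    ∀ ω₂ lam β γ : ℝ, 0 < ω₂ → 0 ≤ lam → 0 < β → 0 < γ →
      (∀ (N : ℕ) (T_L T_R : ℝ), 0 < T_L → 0 < T_R → ∀ μ ν : Measure (PhaseSpace N),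
        (pinnedChain ω₂ lam β γ).IsSteadyState N T_L T_R μ →
        (pinnedChain ω₂ lam β γ).IsSteadyState N T_L T_R ν → μ = ν) →
      ∀ μf : (N : ℕ) → ℝ → ℝ → Measure (PhaseSpace N),
        (∀ (N : ℕ) (T_L T_R : ℝ), 0 < T_L → 0 < T_R →
          (pinnedChain ω₂ lam β γ).IsSteadyState N T_L T_R (μf N T_L T_R)) →
      ∀ T : ℝ, 0 < T → ∀ (N : ℕ) (hN : 2 ≤ N),
        IntegrableOn (fun t : ℝ =>
            (∫ z, (z.2 ⟨0, by omega⟩ * partialQ ⟨0, by omega⟩ ((pinnedChain ω₂ lam β γ).hamiltonian N) z) *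
                (∫ y, y.2 ⟨0, by omega⟩ * partialQ ⟨0, by omega⟩ ((pinnedChain ω₂ lam β γ).hamiltonian N) y
                  ∂((pinnedChain ω₂ lam β γ).transitionKernel N T T t.toNNReal z)) ∂((pinnedChain ω₂ lam β γ).gibbsMeasure N T)) -
              (∫ z, z.2 ⟨0, by omega⟩ * partialQ ⟨0, by omega⟩ ((pinnedChain ω₂ lam β γ).hamiltonian N) z ∂((pinnedChain ω₂ lam β γ).gibbsMeasure N T)) *
                (∫ z, z.2 ⟨0, by omega⟩ * partialQ ⟨0, by omega⟩ ((pinnedChain ω₂ lam β γ).hamiltonian N) z ∂((pinnedChain ω₂ lam β γ).gibbsMeasure N T))) (Set.Ioi 0) ∧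
        Tendsto (fun δ : ℝ => (pinnedChain ω₂ lam β γ).totalCurrent (μf N (T + δ / 2) (T - δ / 2)) / δ) (𝓝[≠] 0)
          (𝓝 (((N : ℝ) - 1) * ((∫ t in Set.Ioi (0 : ℝ), (fun t : ℝ =>
            (∫ z, (z.2 ⟨0, by omega⟩ * partialQ ⟨0, by omega⟩ ((pinnedChain ω₂ lam β γ).hamiltonian N) z) *
                (∫ y, y.2 ⟨0, by omega⟩ * partialQ ⟨0, by omega⟩ ((pinnedChain ω₂ lam β γ).hamiltonian N) y
                  ∂((pinnedChain ω₂ lam β γ).transitionKernel N T T t.toNNReal z)) ∂((pinnedChain ω₂ lam β γ).gibbsMeasure N T)) -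
              (∫ z, z.2 ⟨0, by omega⟩ * partialQ ⟨0, by omega⟩ ((pinnedChain ω₂ lam β γ).hamiltonian N) z ∂((pinnedChain ω₂ lam β γ).gibbsMeasure N T)) *
                (∫ z, z.2 ⟨0, by omega⟩ * partialQ ⟨0, by omega⟩ ((pinnedChain ω₂ lam β γ).hamiltonian N) z ∂((pinnedChain ω₂ lam β γ).gibbsMeasure N T))) t) / T ^ 2))) :=
  -- LANDED (p161365)
  Summit.AtomisticToContinuum.FouriersLaw.Theorems.ContactStieltjesMeasure.CayleyPencil.stub_boundaryGreenKuboNonneg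

/-- STUB 2 (v4: LANDED as `Theorems.ContactStieltjesMeasure.CayleyPencil.stub_pencilOfGreenKubo`, p165213 + 12 helper files): the dissipative pencil realising the boundary Green–Kubo function, `0 ≤ lam`,
`0 < β`. [cite: LaxPhillips1967, Ch. II §3] [cite: KipnisVaradhan1986, Thm 1.8] -/
theorem stub_pencilOfGreenKubo :
    ∀ ω₂ lam β : ℝ, 0 < ω₂ → 0 ≤ lam → 0 < β → ∀ T : ℝ, 0 < T → ∀ (N : ℕ) (hN : 2 ≤ N),
      ∃ (K : Type) (_ : NormedAddCommGroup K) (_ : InnerProductSpace ℝ K) (W : ℝ → K →L[ℝ] K) (g : K),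
        (∀ γ γ' : ℝ, 0 < γ → 0 < γ' → ∀ f : K, W γ f - W γ' f = (γ' - γ) • W γ (W γ' f)) ∧
        (∀ γ : ℝ, 0 < γ → ∀ f : K, inner ℝ f (W γ f) = γ * ‖W γ f‖ ^ 2) ∧
        ∀ γ : ℝ, 0 < γ →
          IntegrableOn (fun t : ℝ =>
            (∫ z, (z.2 ⟨0, by omega⟩ * partialQ ⟨0, by omega⟩ ((pinnedChain ω₂ lam β γ).hamiltonian N) z) *
                (∫ y, y.2 ⟨0, by omega⟩ * partialQ ⟨0, by omega⟩ ((pinnedChain ω₂ lam β γ).hamiltonian N) y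
                  ∂((pinnedChain ω₂ lam β γ).transitionKernel N T T t.toNNReal z)) ∂((pinnedChain ω₂ lam β γ).gibbsMeasure N T)) -
              (∫ z, z.2 ⟨0, by omega⟩ * partialQ ⟨0, by omega⟩ ((pinnedChain ω₂ lam β γ).hamiltonian N) z ∂((pinnedChain ω₂ lam β γ).gibbsMeasure N T)) *
                (∫ z, z.2 ⟨0, by omega⟩ * partialQ ⟨0, by omega⟩ ((pinnedChain ω₂ lam β γ).hamiltonian N) z ∂((pinnedChain ω₂ lam β γ).gibbsMeasure N T))) (Set.Ioi 0) →
            inner ℝ g (W γ g) = (∫ t in Set.Ioi (0 : ℝ), (fun t : ℝ =>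
            (∫ z, (z.2 ⟨0, by omega⟩ * partialQ ⟨0, by omega⟩ ((pinnedChain ω₂ lam β γ).hamiltonian N) z) *
                (∫ y, y.2 ⟨0, by omega⟩ * partialQ ⟨0, by omega⟩ ((pinnedChain ω₂ lam β γ).hamiltonian N) y
                  ∂((pinnedChain ω₂ lam β γ).transitionKernel N T T t.toNNReal z)) ∂((pinnedChain ω₂ lam β γ).gibbsMeasure N T)) -
              (∫ z, z.2 ⟨0, by omega⟩ * partialQ ⟨0, by omega⟩ ((pinnedChain ω₂ lam β γ).hamiltonian N) z ∂((pinnedChain ω₂ lam β γ).gibbsMeasure N T)) *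
                (∫ z, z.2 ⟨0, by omega⟩ * partialQ ⟨0, by omega⟩ ((pinnedChain ω₂ lam β γ).hamiltonian N) z ∂((pinnedChain ω₂ lam β γ).gibbsMeasure N T))) t) / T ^ 2 :=
  -- LANDED (p165213)
  Summit.AtomisticToContinuum.FouriersLaw.Theorems.ContactStieltjesMeasure.CayleyPencil.stub_pencilOfGreenKubo

/-- STUB 4b (v4; the ONLY open stub; vacuous-or-open): the `φ⁴` edge `β = 0 < lam`. [cite: HairerMattingly2009, §1]
[cite: CuneoEckmannHairerReyBellet2018, §1] -/
theorem stub_phi4Edge :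
    ∀ ω₂ lam : ℝ, 0 < ω₂ → 0 < lam → ∀ T : ℝ, 0 < T →
      ∃ Φ : ℕ → ℝ → ℝ, ∀ N : ℕ, 2 ≤ N → Monotone (Φ N) ∧ (∀ s : ℝ, s ≤ 0 → Φ N s = 0) ∧
        (∃ m : ℝ, ∀ s : ℝ, Φ N s ≤ m) ∧ ∀ γ : ℝ, 0 < γ →
          (∀ (N' : ℕ) (T_L T_R : ℝ), 0 < T_L → 0 < T_R → ∀ μ ν : Measure (PhaseSpace N'),
            (pinnedChain ω₂ lam 0 γ).IsSteadyState N' T_L T_R μ →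
            (pinnedChain ω₂ lam 0 γ).IsSteadyState N' T_L T_R ν → μ = ν) →
          ∀ μ : (N' : ℕ) → ℝ → ℝ → Measure (PhaseSpace N'),
            (∀ (N' : ℕ) (T_L T_R : ℝ), 0 < T_L → 0 < T_R →
              (pinnedChain ω₂ lam 0 γ).IsSteadyState N' T_L T_R (μ N' T_L T_R)) →
            Tendsto (fun δ : ℝ => (pinnedChain ω₂ lam 0 γ).totalCurrent (μ N (T + δ / 2) (T - δ / 2)) / δ)
              (𝓝[≠] 0)
              (𝓝 (((N : ℝ) - 1) * γ * ∫ t in Set.Ioi (0 : ℝ), Φ N t * (2 * t / (γ ^ 2 + t ^ 2) ^ 2))) := by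
  sorry

/-! ### Consistency: each named statement IS its stub / its landed theorem (definitionally) -/

theorem boundaryGreenKuboNonneg_holds : BoundaryGreenKuboNonneg := stub_boundaryGreenKuboNonneg
theorem pencilOfGreenKubo_holds : PencilOfGreenKubo := stub_pencilOfGreenKubo
/-- LANDED (p160533). -/
theorem stieltjesOfPencil_holds : StieltjesOfPencil :=
  Summit.AtomisticToContinuum.FouriersLaw.Theorems.ContactStieltjesMeasure.CayleyPencil.stub_stieltjesOfPencil
/-- LANDED (p160339). -/
theorem harmonicMember_holds : HarmonicMember :=
  Summit.AtomisticToContinuum.FouriersLaw.Theorems.ContactStieltjesMeasure.CayleyPencil.stub_harmonicMember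
theorem phi4Edge_holds : Phi4Edge := stub_phi4Edge

/-! ### Name-keyed aliases of the OPEN statements (hypotheses of the composition) -/
namespace Registered

/-- Alias of `BoundaryGreenKuboNonneg` keyed by the registered stub name. -/
abbrev stub_boundaryGreenKuboNonneg : Prop := BoundaryGreenKuboNonneg
/-- Alias of `PencilOfGreenKubo` keyed by the registered stub name. -/
abbrev stub_pencilOfGreenKubo : Prop := PencilOfGreenKubo
/-- Alias of `Phi4Edge` keyed by the registered stub name. -/
abbrev stub_phi4Edge : Prop := Phi4Edge

end Registered

/-! ### The composition: the three open stubs and the two landed theorems imply the crux, BY NAME (no `sorry`) -/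

/-- On the range `0 ≤ lam`, `0 < β`, stubs 1–2 and the landed Stieltjes theorem give, for each `N ≥ 2`, ONE `γ`-free `Φ_N`
representing the response at every `γ > 0`. -/
theorem representation_of_pos (h1 : Registered.stub_boundaryGreenKuboNonneg) (h2 : Registered.stub_pencilOfGreenKubo)
    {ω₂ lam β : ℝ} (hω : 0 < ω₂) (hl : 0 ≤ lam) (hβ : 0 < β) {T : ℝ} (hT : 0 < T) (N : ℕ) (hN : 2 ≤ N) :
    ∃ ΦN : ℝ → ℝ, Monotone ΦN ∧ (∀ s : ℝ, s ≤ 0 → ΦN s = 0) ∧ (∃ m : ℝ, ∀ s : ℝ, ΦN s ≤ m) ∧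
      ∀ γ : ℝ, 0 < γ →
        (∀ (N' : ℕ) (T_L T_R : ℝ), 0 < T_L → 0 < T_R → ∀ μ ν : Measure (PhaseSpace N'),
          (pinnedChain ω₂ lam β γ).IsSteadyState N' T_L T_R μ →
          (pinnedChain ω₂ lam β γ).IsSteadyState N' T_L T_R ν → μ = ν) →
        ∀ μ : (N' : ℕ) → ℝ → ℝ → Measure (PhaseSpace N'),
          (∀ (N' : ℕ) (T_L T_R : ℝ), 0 < T_L → 0 < T_R →
            (pinnedChain ω₂ lam β γ).IsSteadyState N' T_L T_R (μ N' T_L T_R)) →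
          Tendsto (fun δ : ℝ => (pinnedChain ω₂ lam β γ).totalCurrent (μ N (T + δ / 2) (T - δ / 2)) / δ)
            (𝓝[≠] 0)
            (𝓝 (((N : ℝ) - 1) * γ * ∫ t in Set.Ioi (0 : ℝ), ΦN t * (2 * t / (γ ^ 2 + t ^ 2) ^ 2))) := by
  have h3 : StieltjesOfPencil := stieltjesOfPencil_holds
  obtain ⟨K, instK, instK', W, g, hR, hE, hlink⟩ := h2 ω₂ lam β hω hl hβ T hT N hN
  obtain ⟨Φ, hmono, hzero, hbound, hrep⟩ := h3 K W hR hE g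
  refine ⟨Φ, hmono, hzero, ⟨‖g‖ ^ 2, hbound⟩, ?_⟩
  intro γ hγ hU μf hμf
  obtain ⟨hint, htend⟩ := h1 ω₂ lam β γ hω hl hβ hγ hU μf hμf T hT N hN
  have hval := hlink γ hγ hint
  rw [← hval, hrep γ hγ, ← mul_assoc] at htend
  exact htend

/-- `StieltjesRepresentation` from the stubs: case split on the parameter range — on `0 < β` `representation_of_pos` per `N`
and `choose` across `N` (junk `0` below `N = 2`); on `β = 0`: `lam = 0` is the landed harmonic member, `0 < lam` is the
`φ⁴` edge (stub 4b). -/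
theorem StieltjesRepresentation_of (h1 : Registered.stub_boundaryGreenKuboNonneg)
    (h2 : Registered.stub_pencilOfGreenKubo) (h5 : Registered.stub_phi4Edge) :
    Summit.AtomisticToContinuum.FouriersLaw.Theses.ContactStieltjesMeasure.StieltjesRepresentation := by
  have h4 : HarmonicMember := harmonicMember_holds
  intro ω₂ lam β hω hl hβ T hT
  rcases hβ.eq_or_lt with hβ0 | hβpos
  · -- `β = 0`
    subst hβ0
    rcases hl.eq_or_lt with hl0 | hlpos
    · subst hl0
      exact h4 ω₂ hω T hT
    · exact h5 ω₂ lam hω hlpos T hT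
  · -- `0 < β`, `0 ≤ lam`: stubs 1–2 + Stieltjes
    have key := fun (N : ℕ) (hN : 2 ≤ N) => representation_of_pos h1 h2 hω hl hβpos hT N hN
    classical
    refine ⟨fun N => if hN : 2 ≤ N then Classical.choose (key N hN) else fun _ => 0, fun N hN => ?_⟩
    simp only [dif_pos hN]
    exact Classical.choose_spec (key N hN)

/-- Wiring check: the registered stubs feed `StieltjesRepresentation_of` as stated (depends on `sorry` through the three open
stubs only). -/
theorem stieltjesRepresentation_of_stubs :
    Summit.AtomisticToContinuum.FouriersLaw.Theses.ContactStieltjesMeasure.StieltjesRepresentation :=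
  StieltjesRepresentation_of stub_boundaryGreenKuboNonneg stub_pencilOfGreenKubo stub_phi4Edge

end Summit.AtomisticToContinuum.FouriersLaw.Cruxes.StieltjesRepresentation.CayleyPencil

end
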